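import Summits.BirchSwinnertonDyer.Rank1Residual.Additive.SignedTwistPlusDisjoint
import Summits.BirchSwinnertonDyer.Rank1Residual.Additive.SignedTwistMinusLineShape
import Summits.BirchSwinnertonDyer.Rank1Residual.Additive.SignedTwistKummerGroupPadic
import Summits.BirchSwinnertonDyer.Rank1Residual.Additive.SignedConditionToLocalKummer
import HarnessLib

/-!
# The PLUS side of B3's transversality, II: cocycle level — a plus Kummer class over the tower
# lying in `Σ_m ⊔ 𝓚` lies in `𝓚` (cell `bsd-potss`, seat `bsd-potss-ctrl` g2; the `W`-side core of
# the kernel route to the typed reading (L0⁺) `EvenBranchPlusLocalControlZeroAt` = Kobayashi's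
# (9.33) at `n = 0`, TARGET.md v2 §1.1 T-e2-r0; sibling of x1b's `SignedTwistMinusTransverse` §2–§3)

HONEST FRAMING (cell `bsd-potss`, run/shared/lean/pub/bsd-potss/; FULL-BSD rank ≤ 1 programme,
tranche 1b): TOOL THEOREMS ONLY — no definition, no named Literature fact, no Summits-side fact
`def … : Prop`, no `sorry`, axioms standard; the generic binders are x1b's (files 91–93) and are
DISCHARGED in Kobayashi's setting (§4); nothing is booked; no label / mark / count moves; nothing
about (C1_η) or `BSD(W, p)` of any pair is claimed.

## Setting: as in `SignedTwistPlusDisjoint`; `𝓚 = range (localKummerMap)` the Kummer group of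
## `W(ℚ_p)` in `H¹(ℚ_p, W[p^m])`, `Σ_m` the subgroup generated by the minus classes of layer `n`.

* §3 **`mem_range_localKummerMap_of_plus_of_mem_sup`** — a class `ξ ∈ H¹(ℚ_p, W[p^m])` which (a⁺)
  restricts on `Gal(ℚ̄_p/ℚ_n·ℚ_p)` to the Kummer cocycle `u ↦ uR − R` of a `p^m`-th root `R` of a
  PLUS point `x ∈ E⁺_W(n)`, and which lies in `Σ_m ⊔ 𝓚`, LIES IN `𝓚`. Proof: write `ξ = s + k`
  with witnesses `(x_s, R_s, φ_s)` (zero-clause minus, `minus_of_mem_closure`) and `(Q, R_k, φ_k)`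
  (`Q ∈ W(ℚ_p)`, `exists_kummer_cocycle_of_mem_range_localKummerMap`); comparing cocycles on
  `Gal(ℚ̄_p/ℚ_n·ℚ_p)` gives `D := R − R_s − R_k − T₀ ∈ W_n` (`T₀` torsion), hence the point
  identity `x − Q = x_s + p^m • D` with `x − Q ∈ E⁺_W(n)`; by part I `x − Q = p^m • A'`,
  `A' ∈ W_n`, so `T := R − R_k − A'` is `p^m`-torsion and `φ − φ_k` is `u ↦ uT − T` on
  `Gal(ℚ̄_p/ℚ_n·ℚ_p)`; the defect `g ↦ (φ − φ_k)(g) − (gT − T)` is a crossed homomorphism on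
  `Γ_{ℚ_p}` vanishing there, hence valued in `W_n[p^m] = 0`: `φ − φ_k` is a coboundary, `ξ = k ∈ 𝓚`.
* §4 `…_cyclotomic`: Kobayashi's setting (`F = ℚ(μ_p)`, `θ = √p*`, `κ` cyclotomic), all generic
  binders discharged as in x1b's file 93.
With B3 (`Σ_m ⊔ 𝓚 = H¹(ℚ_p, W[p^m])`, x1b file 98) the hypothesis "`ξ ∈ Σ_m ⊔ 𝓚`" is free, and §3
reads: the level-`∞` PLUS Kummer condition at `ℚ_p` pulls back to the classical one — (9.33)⁺ at
`n = 0` (the sequel `QuadraticBranchEvenLocalControl`).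

References: [Kobayashi2003] S. Kobayashi, Invent. Math. 152 (2003), §2 p. 4, Thm. 6.2 (p. 11),
Prop. 8.7 (p. 16), Prop. 8.12 ii) (pp. 17–18), Lemma 8.17 (p. 19), Prop. 9.2 / (9.33) (pp. 26–27);
[GreenbergLNM1716] §3 p. 86; [SerreGaloisCohomology1997] I.§2.4, I.§5.8.
-/

noncomputable section

open scoped Classical

open WeierstrassCurve Field

namespace Summit.BirchSwinnertonDyer.Rank1Residual.Additive.SignedTwist

open Literature.NumberTheory.EllipticCurves Literature.NumberTheory.GaloisRepresentations
  Literature.NumberTheory.EllipticCurves.Kobayashi2003 Literature.NumberTheory.EllipticCurves.ZpDescent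
  Summit.BirchSwinnertonDyer.Rank1Residual.AdditivePotMult
  Summit.BirchSwinnertonDyer.Rank1Residual.Additive.PadicCyclotomicTower
  Summit.BirchSwinnertonDyer.Rank1Residual.Additive.StrictSignedCount
  Summit.BirchSwinnertonDyer.Rank1Residual.Additive.LevelBridge
  ZpExtension
open scoped ContRepresentation

section Generic

variable (W : WeierstrassCurve ℚ) [W.IsElliptic] (K₀ : Type) [Field K₀] [NumberField K₀] {θ : K₀} {c : ℚ}
  (hθ : θ ∉ Set.range (algebraMap ℚ K₀)) (hc : θ ^ 2 = algebraMap ℚ K₀ c)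
  {p : ℕ} [hp : Fact p.Prime] (κ : ZpExtension ℚ p)
  {V : WeierstrassCurve ℚ} [V.IsElliptic] {C : VariableChange ℚ} (hCV : C • W.quadraticTwist c = V)
  (η : absoluteGaloisGroup ℚ →* ℤˣ)
  (hη : ∀ σ : absoluteGaloisGroup ℚ, η σ = 1 ↔ σ • rootInClosure K₀ θ = rootInClosure K₀ θ)

/-! ## §3 Cocycle level: a plus class in `Σ_m ⊔ 𝓚` lies in `𝓚` -/

set_option maxHeartbeats 400000 in
include hθ hc hCV hη in
/-- **PLUS TRANSVERSALITY (B3⁺, cocycle currency).** Under x1b's generic tower hypotheses: a class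
`ξ ∈ H¹(ℚ_p, W[p^m])` which (a⁺) restricts on `Gal(ℚ̄_p/ℚ_n·ℚ_p)` to the Kummer cocycle
`u ↦ uR − R` of a `p^m`-th root `R` of a PLUS point `x ∈ E⁺_W(n)`, and which lies in `Σ_m ⊔ 𝓚`
(`Σ_m` generated by the minus classes of layer `n`, `𝓚` the Kummer group of `W(ℚ_p)`), LIES IN `𝓚`.
See the module docstring for the proof (point identity `x − Q = x_s + p^m D` ⟹ §2 ⟹ `φ − φ_k` is a
coboundary by a crossed-homomorphism argument, `W_n[p^m] = 0`).
[cite: Kobayashi2003, Thm. 6.2 (p. 11), Prop. 8.12 ii) (pp. 17–18), Lemma 8.17 (p. 19), Prop. 8.7 (p. 16), (9.33) (p. 26)]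
[cite: SerreGaloisCohomology1997, I.§5.8] -/
theorem mem_range_localKummerMap_of_plus_of_mem_sup
    (hD : ∀ g : absoluteGaloisGroup ℚ, ∃ τ : absoluteGaloisGroup ℚ_[p],
      (resGalOfEmb (closureEmb (K := ℚ) ℚ_[p]) τ)⁻¹ * g ∈ towerTopSubgroup κ K₀)
    (hκ₀ : ∀ x, ∃ g ∈ galRange (K := ℚ) K₀, κ g = x) [(galRange (K := ℚ) K₀).Normal]
    (hidx : (galRange (K := ℚ) K₀).index ≤ p - 1) (hp2 : p ≠ 2)
    (M : WeierstrassCurve ℤ_[p]) [hE : (M.map PadicInt.Coe.ringHom).IsElliptic]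
    [hEt : (M.map PadicInt.toZMod).IsElliptic]
    (htr : Literature.NumberTheory.EllipticCurves.HasseManin.tr (M.map PadicInt.toZMod) = 0)
    (hVM : M.baseChange (AlgebraicClosure ℚ_[p]) = V.baseChange (AlgebraicClosure ℚ_[p]))
    (hU : ∀ n, localSubgroupOfEmb (towerSubgroup κ K₀ n) (closureEmb (K := ℚ) ℚ_[p]) = stab p (n + 1))
    {n m : ℕ}
    {ξ : galoisCohomology (GaloisRep.restrictField ℚ_[p] (W.torsionGaloisModule ((p ^ m : ℕ) : ℤ))) 1}
    (hplus : ∃ x ∈ signedLocalPointsOfEmb κ (closureEmb (K := ℚ) ℚ_[p]) W 1 n,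
        ∃ R : localPoints W ℚ_[p], ((p ^ m : ℕ) : ℤ) • R = x ∧
        ∃ φ : contOneCocycles (DiscreteGaloisModule.toTopRep
            (GaloisRep.restrictField ℚ_[p] (W.torsionGaloisModule ((p ^ m : ℕ) : ℤ)))),
          oneCocycleClass _ φ = ξ ∧
          ∀ u ∈ localLayerSubgroupOfEmb κ (closureEmb (K := ℚ) ℚ_[p]) n,
            pointsMap W ℚ_[p] ((φ.1 u : geomTorsion W ((p ^ m : ℕ) : ℤ)) : geomPoints W) = u • R - R)
    (hmem : ξ ∈ AddSubgroup.closure {ξ : galoisCohomology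
        (GaloisRep.restrictField ℚ_[p] (W.torsionGaloisModule ((p ^ m : ℕ) : ℤ))) 1 |
        ∃ x ∈ signedLocalPointsOfEmb κ (closureEmb (K := ℚ) ℚ_[p]) W (-1) n ⊓
          (localTraceOfEmb κ (closureEmb (K := ℚ) ℚ_[p]) W 0 n).ker,
        ∃ R : localPoints W ℚ_[p], ((p ^ m : ℕ) : ℤ) • R = x ∧
        ∃ φ : contOneCocycles (DiscreteGaloisModule.toTopRep
            (GaloisRep.restrictField ℚ_[p] (W.torsionGaloisModule ((p ^ m : ℕ) : ℤ)))),
          oneCocycleClass _ φ = ξ ∧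
          ∀ u ∈ localLayerSubgroupOfEmb κ (closureEmb (K := ℚ) ℚ_[p]) n,
            pointsMap W ℚ_[p] ((φ.1 u : geomTorsion W ((p ^ m : ℕ) : ℤ)) : geomPoints W) = u • R - R} ⊔
      (W.localKummerMap ℚ_[p]
        (show (((p ^ m : ℕ) : ℤ)) ≠ 0 by exact_mod_cast pow_ne_zero m hp.out.ne_zero)).range) :
    ξ ∈ (W.localKummerMap ℚ_[p]
        (show (((p ^ m : ℕ) : ℤ)) ≠ 0 by exact_mod_cast pow_ne_zero m hp.out.ne_zero)).range := by
  set ι := closureEmb (K := ℚ) ℚ_[p] with hι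
  have hnn0 : ((p ^ m : ℕ) : ℤ) ≠ 0 := by exact_mod_cast pow_ne_zero m hp.out.ne_zero
  have htorsn := eq_zero_of_prime_smul_eq_zero_localLayerPointsOfEmb W K₀ hθ hc κ hCV η hη hp2 M htr hVM hU n
  -- the three witnesses
  obtain ⟨s, hs, k, hk, hsk⟩ := AddSubgroup.mem_sup.mp hmem
  obtain ⟨xs, hxs, Rs, hRs, φs, hφs, hφsu⟩ := minus_of_mem_closure W κ ℚ_[p] n hs
  obtain ⟨Q, hQ, Rk, hRk, φk, hφk, hφku⟩ := exists_kummer_cocycle_of_mem_range_localKummerMap W κ m hk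
  obtain ⟨x, hx, R, hR, φ, hφ, hφu⟩ := hplus
  -- `φ − φ_s − φ_k` is the coboundary of a torsion point `T₀`
  have h0 : oneCocycleClass _ (φ - φs - φk) = 0 := by
    rw [oneCocycleClass_sub, oneCocycleClass_sub, hφ, hφs, hφk]
    -- the two (definitionally equal) group structures on `H¹` meet here: cross by `exact`
    have hA : ξ - s - k = 0 := by rw [← hsk]; abel
    exact hA
  obtain ⟨v, hv⟩ := (oneCocycleClass_eq_zero_iff _ _).mp h0
  obtain ⟨T₀, hT₀⟩ : ∃ T₀ : localPoints W ℚ_[p],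
      T₀ = pointsMap W ℚ_[p] ((v : geomTorsion W ((p ^ m : ℕ) : ℤ)) : geomPoints W) := ⟨_, rfl⟩
  have hT₀tor : ((p ^ m : ℕ) : ℤ) • T₀ = 0 := by
    rw [hT₀, ← map_zsmul]
    have : ((p ^ m : ℕ) : ℤ) • ((v : geomTorsion W ((p ^ m : ℕ) : ℤ)) : geomPoints W) = 0 := v.2
    rw [this, map_zero]
  -- `D := R − R_s − R_k − T₀ ∈ W_n`
  have hfix : ∀ u ∈ localLayerSubgroupOfEmb κ ι n, u • (R - Rs - Rk - T₀) = R - Rs - Rk - T₀ := by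
    intro u hu
    have h1 := congrArg (fun z : geomTorsion W ((p ^ m : ℕ) : ℤ) => pointsMap W ℚ_[p] (z : geomPoints W))
      (hv u)
    simp only at h1
    have hl : pointsMap W ℚ_[p] (((φ - φs - φk).1 u : geomTorsion W ((p ^ m : ℕ) : ℤ)) : geomPoints W) =
        (u • R - R) - (u • Rs - Rs) - (u • Rk - Rk) := by
      rw [← hφu u hu, ← hφsu u hu, ← hφku u, ← map_sub, ← map_sub]
      rfl
    have hr : pointsMap W ℚ_[p] ((((DiscreteGaloisModule.toTopRep
        (GaloisRep.restrictField ℚ_[p] (W.torsionGaloisModule ((p ^ m : ℕ) : ℤ)))).ρ u v - v :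
          geomTorsion W ((p ^ m : ℕ) : ℤ))) : geomPoints W) = u • T₀ - T₀ := by
      change pointsMap W ℚ_[p] (((absGaloisRestrict ℚ ℚ_[p] u • v - v :
        geomTorsion W ((p ^ m : ℕ) : ℤ))) : geomPoints W) = _
      rw [← resGal_eq_absGaloisRestrict, AddSubgroup.coe_sub, map_sub, hT₀]
      congr 1
      exact pointsMap_smul W ℚ_[p] u _
    rw [hl, hr] at h1
    rw [smul_sub, smul_sub, smul_sub]
    linear_combination (norm := abel_nf) h1
  have hDn : R - Rs - Rk - T₀ ∈ localLayerPointsOfEmb κ ι W n :=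
    (mem_localLayerPointsOfEmb_iff κ ι W n _).mpr hfix
  -- the point identity `x − Q = x_s + p^m • D`, with `x − Q ∈ E⁺_W(n)`
  have hxQ : x - Q = xs + p ^ m • (R - Rs - Rk - T₀) := by
    rw [← natCast_zsmul, zsmul_sub, zsmul_sub, zsmul_sub, hR, hRs, hRk, hT₀tor]
    abel
  have hxQplus : x - Q ∈ signedLocalPointsOfEmb κ ι W 1 n :=
    sub_mem hx (localLayerPointsOfEmb_zero_le_signedLocalPointsOfEmb κ ι W 1 n hQ)
  obtain ⟨A', hA'n, hA'⟩ := exists_eq_pow_smul_of_plus_eq_zeroClause_add_pow_smul W K₀ hθ hc κ hCV η hη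
    hD hκ₀ hidx hp2 M htr hVM hU m hxQplus hxs hDn hxQ
  -- `T := R − R_k − A'` is `p^m`-torsion and `φ − φ_k = (u ↦ uT − T)` on `Gal(ℚ̄_p/ℚ_n·ℚ_p)`
  obtain ⟨T, hTdef⟩ : ∃ T : localPoints W ℚ_[p], T = R - Rk - A' := ⟨_, rfl⟩
  have hTtor : ((p ^ m : ℕ) : ℤ) • T = 0 := by
    rw [hTdef, zsmul_sub, zsmul_sub, hR, hRk, natCast_zsmul, ← hA', sub_self]
  have hA'fix : ∀ u ∈ localLayerSubgroupOfEmb κ ι n, u • A' = A' :=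
    fun u hu ↦ (mem_localLayerPointsOfEmb_iff κ ι W n A').mp hA'n u hu
  have hψu : ∀ u ∈ localLayerSubgroupOfEmb κ ι n,
      pointsMap W ℚ_[p] (((φ - φk).1 u : geomTorsion W ((p ^ m : ℕ) : ℤ)) : geomPoints W) = u • T - T := by
    intro u hu
    have hl : pointsMap W ℚ_[p] (((φ - φk).1 u : geomTorsion W ((p ^ m : ℕ) : ℤ)) : geomPoints W) =
        (u • R - R) - (u • Rk - Rk) := by
      rw [← hφu u hu, ← hφku u, ← map_sub]
      rfl
    rw [hl, hTdef, smul_sub, smul_sub, hA'fix u hu]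
    abel
  -- the cocycle identity of `φ − φ_k` on points
  have hcoc : ∀ a b : absoluteGaloisGroup ℚ_[p],
      pointsMap W ℚ_[p] (((φ - φk).1 (a * b) : geomTorsion W ((p ^ m : ℕ) : ℤ)) : geomPoints W) =
        pointsMap W ℚ_[p] (((φ - φk).1 a : geomTorsion W ((p ^ m : ℕ) : ℤ)) : geomPoints W) +
          a • pointsMap W ℚ_[p] (((φ - φk).1 b : geomTorsion W ((p ^ m : ℕ) : ℤ)) : geomPoints W) := by
    intro a b
    have h := congrArg (fun z : geomTorsion W ((p ^ m : ℕ) : ℤ) => pointsMap W ℚ_[p] (z : geomPoints W))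
      ((φ - φk).2 a b)
    simp only at h
    rw [h, AddMemClass.coe_add, map_add]
    congr 1
    change pointsMap W ℚ_[p] (((absGaloisRestrict ℚ ℚ_[p] a • (φ - φk).1 b :
      geomTorsion W ((p ^ m : ℕ) : ℤ))) : geomPoints W) = _
    rw [← resGal_eq_absGaloisRestrict]
    exact pointsMap_smul W ℚ_[p] a _
  -- the defect crossed homomorphism `f(g) = (φ − φ_k)(g) − (gT − T)` vanishes on `Gal(ℚ̄_p/ℚ_n·ℚ_p)`
  obtain ⟨f, hf⟩ : ∃ f : absoluteGaloisGroup ℚ_[p] → localPoints W ℚ_[p], ∀ g, f g =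
      pointsMap W ℚ_[p] (((φ - φk).1 g : geomTorsion W ((p ^ m : ℕ) : ℤ)) : geomPoints W) - (g • T - T) :=
    ⟨_, fun g => rfl⟩
  have hfcoc : ∀ a b : absoluteGaloisGroup ℚ_[p], f (a * b) = f a + a • f b := by
    intro a b
    rw [hf, hf, hf, hcoc, mul_smul, smul_sub, smul_sub]
    abel
  have hfN : ∀ u ∈ localLayerSubgroupOfEmb κ ι n, f u = 0 := by
    intro u hu
    rw [hf, hψu u hu, sub_self]
  haveI hNn : (localLayerSubgroupOfEmb κ ι n).Normal := normal_localSubgroupOfEmb ι (κ.layerSubgroup n)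
  have hfix' : ∀ g : absoluteGaloisGroup ℚ_[p], f g ∈ localLayerPointsOfEmb κ ι W n := by
    intro g
    rw [mem_localLayerPointsOfEmb_iff]
    intro u hu
    exact smul_eq_of_crossedHom_of_vanishing f hfcoc _ hfN g hu
  -- … and its values are `p^m`-torsion, hence zero (`W_n` has no `p`-torsion)
  have hfzero : ∀ g : absoluteGaloisGroup ℚ_[p], f g = 0 := by
    intro g
    have htor : p ^ m • f g = 0 := by
      rw [hf, smul_sub, ← map_nsmul, ← AddSubgroupClass.coe_nsmul, Summit.BirchSwinnertonDyer.Rank1Residual.X11b.Levels.pow_nsmul_geomTorsion_eq_zero W p m,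
        ZeroMemClass.coe_zero, map_zero, zero_sub, neg_eq_zero, smul_sub, smul_comm, ← natCast_zsmul,
        hTtor, smul_zero, sub_self]
    exact noTorsion_pow (localLayerPointsOfEmb κ ι W n) htorsn m (f g) (hfix' g) htor
  -- so `φ − φ_k` is the coboundary of the torsion point `T`: `ξ − k = 0`
  have htorT : T ∈ AddSubgroup.torsionBy (localPoints W ℚ_[p]) ((p ^ m : ℕ) : ℤ) := hTtor
  obtain ⟨v₀, hv₀T⟩ : ∃ v₀ : geomTorsion W ((p ^ m : ℕ) : ℤ),
      pointsMap W ℚ_[p] ((v₀ : geomTorsion W ((p ^ m : ℕ) : ℤ)) : geomPoints W) = T :=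
    ⟨(W.torsionPointsEquiv ((p ^ m : ℕ) : ℤ) (E := ℚ_[p]) hnn0).symm ⟨T, htorT⟩,
      W.pointsMap_torsionPointsEquiv_symm ((p ^ m : ℕ) : ℤ) hnn0 _⟩
  have hcob : oneCocycleClass _ (φ - φk) = 0 := by
    refine (oneCocycleClass_eq_zero_iff _ _).mpr ⟨v₀, fun u => ?_⟩
    apply Subtype.ext
    apply pointsMapOfEmb_injective W (closureEmb (K := ℚ) ℚ_[p])
    change pointsMap W ℚ_[p] (((φ - φk).1 u : geomTorsion W ((p ^ m : ℕ) : ℤ)) : geomPoints W) =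
      pointsMap W ℚ_[p] ((((DiscreteGaloisModule.toTopRep
        (GaloisRep.restrictField ℚ_[p] (W.torsionGaloisModule ((p ^ m : ℕ) : ℤ)))).ρ u v₀ - v₀ :
          geomTorsion W ((p ^ m : ℕ) : ℤ))) : geomPoints W)
    have hr : pointsMap W ℚ_[p] ((((DiscreteGaloisModule.toTopRep
        (GaloisRep.restrictField ℚ_[p] (W.torsionGaloisModule ((p ^ m : ℕ) : ℤ)))).ρ u v₀ - v₀ :
          geomTorsion W ((p ^ m : ℕ) : ℤ))) : geomPoints W) = u • T - T := by
      change pointsMap W ℚ_[p] (((absGaloisRestrict ℚ ℚ_[p] u • v₀ - v₀ :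
        geomTorsion W ((p ^ m : ℕ) : ℤ))) : geomPoints W) = _
      rw [← resGal_eq_absGaloisRestrict, AddSubgroup.coe_sub, map_sub, hv₀T]
      congr 1
      rw [← hv₀T]
      exact pointsMap_smul W ℚ_[p] u _
    rw [hr]
    have h := hfzero u
    rw [hf] at h
    exact sub_eq_zero.mp h
  have hξk : ξ = k := by
    have h1 : oneCocycleClass _ (φ - φk) = ξ - k := by rw [oneCocycleClass_sub, hφ, hφk]; exact rfl
    rw [h1] at hcob
    exact sub_eq_zero.mp hcob
  rw [hξk]
  exact hk

end Generic

/-! ## §4 Kobayashi's setting -/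

section Cyclotomic

variable (W : WeierstrassCurve ℚ) [W.IsElliptic] {p : ℕ} [hp : Fact p.Prime] (κ : ZpExtension ℚ p)
  {V : WeierstrassCurve ℚ} [V.IsElliptic]
  (F : Type) [Field F] [NumberField F] [IsCyclotomicExtension {p} ℚ F]

include F in
/-- **Plus transversality, Kobayashi's setting** (`F` a `p`-th cyclotomic field, `κ` cyclotomic,
`V = C • W^{(p*)}` with a good supersingular `a_p = 0` model, `p` odd): a class of `H¹(ℚ_p, W[p^m])`
with a PLUS Kummer witness at layer `n` (hypothesis (a⁺) of
`mem_range_localKummerMap_of_plus_of_mem_sup`) lying in `Σ_m ⊔ 𝓚` lies in `𝓚` — all generic tower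
binders discharged as in x1b's file 93 (`localTowerHyp_padic`, `kappa_surjOn_galRange_cyclotomic`,
`index_galRange_cyclotomic`, `localSubgroupOfEmb_towerSubgroup_eq_stab_rat`).
[cite: Kobayashi2003, §3 p. 5, Thm. 6.2 (p. 11), Prop. 8.12 ii) (pp. 17–18), Lemma 8.17 (p. 19), (9.33) (p. 26)] -/
theorem mem_range_localKummerMap_of_plus_of_mem_sup_cyclotomic (hp2 : p ≠ 2) (hκ : κ.IsCyclotomic)
    (C : VariableChange ℚ) (hCV : C • W.quadraticTwist ((-1) ^ (p / 2) * p) = V)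
    (M : WeierstrassCurve ℤ_[p]) [hE : (M.map PadicInt.Coe.ringHom).IsElliptic]
    [hEt : (M.map PadicInt.toZMod).IsElliptic]
    (htr : Literature.NumberTheory.EllipticCurves.HasseManin.tr (M.map PadicInt.toZMod) = 0)
    (hVM : M.baseChange (AlgebraicClosure ℚ_[p]) = V.baseChange (AlgebraicClosure ℚ_[p]))
    {n m : ℕ}
    {ξ : galoisCohomology (GaloisRep.restrictField ℚ_[p] (W.torsionGaloisModule ((p ^ m : ℕ) : ℤ))) 1}
    (hplus : ∃ x ∈ signedLocalPointsOfEmb κ (closureEmb (K := ℚ) ℚ_[p]) W 1 n,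
        ∃ R : localPoints W ℚ_[p], ((p ^ m : ℕ) : ℤ) • R = x ∧
        ∃ φ : contOneCocycles (DiscreteGaloisModule.toTopRep
            (GaloisRep.restrictField ℚ_[p] (W.torsionGaloisModule ((p ^ m : ℕ) : ℤ)))),
          oneCocycleClass _ φ = ξ ∧
          ∀ u ∈ localLayerSubgroupOfEmb κ (closureEmb (K := ℚ) ℚ_[p]) n,
            pointsMap W ℚ_[p] ((φ.1 u : geomTorsion W ((p ^ m : ℕ) : ℤ)) : geomPoints W) = u • R - R)
    (hmem : ξ ∈ AddSubgroup.closure {ξ : galoisCohomology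
        (GaloisRep.restrictField ℚ_[p] (W.torsionGaloisModule ((p ^ m : ℕ) : ℤ))) 1 |
        ∃ x ∈ signedLocalPointsOfEmb κ (closureEmb (K := ℚ) ℚ_[p]) W (-1) n ⊓
          (localTraceOfEmb κ (closureEmb (K := ℚ) ℚ_[p]) W 0 n).ker,
        ∃ R : localPoints W ℚ_[p], ((p ^ m : ℕ) : ℤ) • R = x ∧
        ∃ φ : contOneCocycles (DiscreteGaloisModule.toTopRep
            (GaloisRep.restrictField ℚ_[p] (W.torsionGaloisModule ((p ^ m : ℕ) : ℤ)))),
          oneCocycleClass _ φ = ξ ∧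
          ∀ u ∈ localLayerSubgroupOfEmb κ (closureEmb (K := ℚ) ℚ_[p]) n,
            pointsMap W ℚ_[p] ((φ.1 u : geomTorsion W ((p ^ m : ℕ) : ℤ)) : geomPoints W) = u • R - R} ⊔
      (W.localKummerMap ℚ_[p]
        (show (((p ^ m : ℕ) : ℤ)) ≠ 0 by exact_mod_cast pow_ne_zero m hp.out.ne_zero)).range) :
    ξ ∈ (W.localKummerMap ℚ_[p]
        (show (((p ^ m : ℕ) : ℤ)) ≠ 0 by exact_mod_cast pow_ne_zero m hp.out.ne_zero)).range := by
  obtain ⟨θ, hθ2⟩ := exists_sq_eq_pStar p F hp2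
  have hc : θ ^ 2 = algebraMap ℚ F ((-1) ^ (p / 2) * p) := by
    rw [hθ2, map_mul, map_pow, map_neg, map_one, map_natCast]
  have hθ : θ ∉ Set.range (algebraMap ℚ F) := by
    rintro ⟨q, hq⟩
    apply sq_ne_neg_one_pow_mul_prime hp.out (p / 2) q
    apply (algebraMap ℚ F).injective
    rw [map_pow, hq, hc]
  obtain ⟨η, hη⟩ := exists_eta_iff_smul_rootInClosure F hθ hc
  haveI := normal_galRange_cyclotomic p F
  exact mem_range_localKummerMap_of_plus_of_mem_sup W F hθ hc κ hCV η hη (localTowerHyp_padic p κ F hκ)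
    (kappa_surjOn_galRange_cyclotomic κ F) (index_galRange_cyclotomic p F).le hp2 M htr hVM
    (localSubgroupOfEmb_towerSubgroup_eq_stab_rat F (closureEmb (K := ℚ) ℚ_[p]) κ hp2 hκ) hplus hmem

end Cyclotomic

end Summit.BirchSwinnertonDyer.Rank1Residual.Additive.SignedTwist

end
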